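import Summits.CriticalPhenomena.CardyFormulaZ2.Theorems.CardyMeckeFlipLawToCrossingsQuads
import Literature.Probability.Percolation.QuadCrossingNoiseDiscrete
import Literature.Probability.Percolation.BoxCrossingProofs
import Literature.Topology.PlaneTopology.BandCrossing
import HarnessLib

/-!
# The crude crossing event forces the easier quads of `R` to be crossed

Support file for item `LawToCrossings` (stmt-CriticalPhenomena-14828) of route `CardyMeckeFlip`,
sub-problem `CardyFormulaZ2`: the UPPER half of the bridge between the Schramm–Smirnov encoding
`ω ↦ S_ω ∈ ℋ_ℂ` and the crude embedded crossing event of a conformal rectangle `R`.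

Let `Φ` be a square model of `R`, `H = rotI.trans Φ`, and `Q_{a,b} = rectQuad H a b` (so
`Q_{1,1}` is the quad of `R`, `Q_{1-s,1+s}` its shorter-and-taller, EASIER perturbation).  The
crude event at mesh `δ` is an open lattice path with all vertices in `Ω = R.carrier`, from a
vertex within `2δ` of `R.arc 0` to a vertex within `2δ` of `R.arc 2`.

* `exists_polyline_of_walk` — the drawn polyline of such a path: compact, connected, through the
  two end vertices, within `δ` of `Ω`, and inside the drawn open edges `openEdgeUnion δ ω`
  (unless the path is trivial);
* `crude_subset_crossed` — **for `δ < δ₀(R, s)` the crude event forces `Q_{1-s,1+s} ∈ S_ω`**: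
  read through `H⁻¹` (uniformly continuous near the closed quad) the polyline is a continuum in
  the band `|Im| ≤ 1 + η` joining `{Re ≤ -1 + η}` to `{Re ≥ 1 - η}`, so it contains a crossing of
  the rectangle `[-(1-s), 1-s] × [-(1+s), 1+s]` (`exists_subcontinuum_crossing`), whose image is a
  crossing of `Q_{1-s,1+s}` inside the open edges;
* `prob_crude_le_z2QuadLaw` — hence `P_{1/2}[crude] ≤ μ_δ(⊞_{Q_{1-s,1+s}})` for `δ < δ₀`.

References: O. Schramm, S. Smirnov, Ann. Probab. 39 (2011), §1.3 and §3 (3.2).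
-/

noncomputable section

open Set Filter MeasureTheory Metric Complex
open scoped Topology unitInterval ENNReal
open Literature.Probability.Percolation Literature.Probability.Percolation.QuadCrossing
open Literature.Probability.RandomPlanarGeometry Literature.Probability.LatticeModels
open Literature.Topology.PlaneTopology

namespace Summit.CriticalPhenomena.CardyFormulaZ2.Theorems.MeckeFlipBridge

/-! ### The drawn polyline of an open lattice path -/

/-- **The drawn polyline of an open path.**  Let `ω ⊆ E(ℤ²)` and let `W` be a walk in the open
graph of `ω` induced on a vertex set `S`.  Then there is a compact connected plane set `L`
through the mesh points of the two ends of `W`, every point of which is within `δ` of the mesh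
point of a vertex of `S`, and which is either the single starting point or lies inside the drawn
open edges `openEdgeUnion δ ω` (the union of the segments of the steps of `W`). -/
theorem exists_polyline_of_walk {δ : ℝ} (hδ : 0 < δ) {ω : BondConfig (Site 2)}
    (hω : ω ⊆ (zdGraph 2).edgeSet) {S : Set (Site 2)} :
    ∀ {a b : S} (_ : ((openGraph ω).induce S).Walk a b),
      ∃ L : Set ℂ, IsCompact L ∧ IsConnected L ∧ meshPoint δ a ∈ L ∧ meshPoint δ b ∈ L ∧
        (∀ z ∈ L, ∃ x ∈ S, dist z (meshPoint δ x) ≤ δ) ∧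
        (L = {meshPoint δ (a : Site 2)} ∨ L ⊆ openEdgeUnion δ ω) := by
  intro a b W
  induction W with
  | nil =>
    rename_i a
    exact ⟨{meshPoint δ (a : Site 2)}, isCompact_singleton, isConnected_singleton, rfl, rfl,
      fun z hz => ⟨a, a.2, by rw [mem_singleton_iff.1 hz, dist_self]; exact hδ.le⟩, Or.inl rfl⟩
  | cons hadj W' ih =>
    rename_i a c b
    obtain ⟨L', hL'c, hL'conn, hcL', hbL', hnear, hO⟩ := ih
    have hadj' : (openGraph ω).Adj (a : Site 2) (c : Site 2) := hadj
    rw [openGraph_adj] at hadj'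
    have hzd : (zdGraph 2).Adj (a : Site 2) (c : Site 2) := by
      have := hω hadj'.1
      exact (SimpleGraph.mem_edgeSet _).1 this
    set T : Set ℂ := segment ℝ (meshPoint δ (a : Site 2)) (meshPoint δ (c : Site 2)) with hT
    have hTO : T ⊆ openEdgeUnion δ ω := fun z hz =>
      mem_openEdgeUnion_iff.2 ⟨a, c, hzd, hadj'.1, hz⟩
    have hTc : IsCompact T := by
      rw [hT, segment_eq_image_lineMap]
      exact isCompact_Icc.image AffineMap.lineMap_continuous
    have hTconn : IsConnected T := by
      rw [hT, segment_eq_image_lineMap]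
      exact (isConnected_Icc (zero_le_one' ℝ)).image _ AffineMap.lineMap_continuous.continuousOn
    refine ⟨T ∪ L', hTc.union hL'c, ?_, Or.inl (left_mem_segment _ _ _), Or.inr hbL', ?_, Or.inr ?_⟩
    · exact IsConnected.union ⟨meshPoint δ (c : Site 2), right_mem_segment _ _ _, hcL'⟩ hTconn hL'conn
    · rintro z (hz | hz)
      · refine ⟨a, a.2, ?_⟩
        have hseg : T ⊆ closedBall (meshPoint δ (a : Site 2)) δ := by
          refine (convex_closedBall _ _).segment_subset (mem_closedBall_self hδ.le) ?_
          rw [mem_closedBall, dist_comm, dist_meshPoint_of_adj hzd, abs_of_pos hδ]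
        exact mem_closedBall.1 (hseg hz)
      · exact hnear z hz
    · rintro z (hz | hz)
      · exact hTO hz
      · rcases hO with hO | hO
        · rw [hO, mem_singleton_iff] at hz
          rw [hz]
          exact hTO (right_mem_segment _ _ _)
        · exact hO hz

/-! ### Reading the plane through `H⁻¹` near the closed quad -/

/-- **Uniform continuity of `H⁻¹` near a compact set.**  For a plane homeomorphism `H`, a
compact `C` and `η > 0` there is `θ ∈ (0, 1]` such that points within `θ` of each other, one of
them in `C`, the other within distance `1` of `C`, have `H⁻¹`-images within `η`. -/
theorem exists_forall_dist_symm_lt (H : ℂ ≃ₜ ℂ) {C : Set ℂ} (hC : IsCompact C) {η : ℝ}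
    (hη : 0 < η) :
    ∃ θ : ℝ, 0 < θ ∧ θ ≤ 1 ∧ ∀ p ∈ C, ∀ z : ℂ, dist z p < θ → dist (H.symm z) (H.symm p) < η := by
  have hCc : IsCompact (cthickening 1 C) := hC.cthickening
  obtain ⟨θ, hθ, hHθ⟩ := Metric.uniformContinuousOn_iff.1
    (hCc.uniformContinuousOn_of_continuous H.symm.continuous.continuousOn) η hη
  refine ⟨min θ 1, lt_min hθ one_pos, min_le_right _ _, fun p hp z hz => ?_⟩
  have hz1 : z ∈ cthickening 1 C :=
    mem_cthickening_of_dist_le z p 1 C hp (hz.le.trans (min_le_right _ _))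
  exact hHθ z hz1 p (self_subset_cthickening _ hp) (hz.trans_le (min_le_left _ _))

/-! ### The crude event forces the easier quad to be crossed -/

section SquareModel

variable {R : ConformalRectangle} {Φ : ℂ ≃ₜ ℂ} (h : IsSquareModel R Φ)
include h

/-- The preimage of the closed quad under `H = rotI.trans Φ` is the square `[-1, 1]²`. -/
theorem symm_image_closure (z : ℂ) (hz : z ∈ closure R.carrier) :
    ((Homeomorph.mulLeft₀ Complex.I Complex.I_ne_zero).trans Φ).symm z ∈
      Icc (-1 : ℝ) 1 ×ℂ Icc (-1 : ℝ) 1 := by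
  have hc := carrier_rq ((Homeomorph.mulLeft₀ Complex.I Complex.I_ne_zero).trans Φ) one_pos one_pos
  rw [carrier_quadOf h] at hc
  rw [hc] at hz
  obtain ⟨w, hw, rfl⟩ := hz
  rw [Homeomorph.symm_apply_apply]
  exact hw

/-- The preimage of `R.arc 0` under `H` is the left side `{-1} × [-1, 1]` of the square. -/
theorem symm_image_arc_zero (z : ℂ) (hz : z ∈ R.arc 0) :
    (((Homeomorph.mulLeft₀ Complex.I Complex.I_ne_zero).trans Φ).symm z).re = -1 := by
  have hs := side_zero_rq ((Homeomorph.mulLeft₀ Complex.I Complex.I_ne_zero).trans Φ) one_pos one_pos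
  rw [side_zero_quadOf h] at hs
  rw [hs] at hz
  obtain ⟨w, hw, rfl⟩ := hz
  rw [Homeomorph.symm_apply_apply]
  exact hw.1

/-- The preimage of `R.arc 2` under `H` is the right side `{1} × [-1, 1]` of the square. -/
theorem symm_image_arc_two (z : ℂ) (hz : z ∈ R.arc 2) :
    (((Homeomorph.mulLeft₀ Complex.I Complex.I_ne_zero).trans Φ).symm z).re = 1 := by
  have hs := side_two_rq ((Homeomorph.mulLeft₀ Complex.I Complex.I_ne_zero).trans Φ) one_pos one_pos
  rw [side_two_quadOf h] at hs
  rw [hs] at hz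
  obtain ⟨w, hw, rfl⟩ := hz
  rw [Homeomorph.symm_apply_apply]
  exact hw.1

/-- **The crude crossing event forces the easier quad `Q_{1-s,1+s}` of `R` to be crossed, for
small mesh.**  For `s ∈ (0, 1/2]` there is `δ₀ > 0` such that for `0 < δ < δ₀` and every
configuration `ω ⊆ E(ℤ²)` in the crude event (an open path with vertices in `Ω` from within `2δ`
of `R.arc 0` to within `2δ` of `R.arc 2`), the quad `rectQuad H (1 - s) (1 + s)` belongs to
`S_ω = z2QuadConfig univ δ ω`. -/
theorem crude_subset_crossed {s : ℝ} (hs : 0 < s) (hs' : s ≤ 1 / 2) :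
    ∃ δ₀ : ℝ, 0 < δ₀ ∧ ∀ δ : ℝ, 0 < δ → δ < δ₀ → ∀ ω : BondConfig (Site 2),
      ω ⊆ (zdGraph 2).edgeSet →
      ω ∈ openCrossing {x : Site 2 | meshPoint δ x ∈ R.carrier}
        {u | infDist (meshPoint δ u) (R.arc 0) ≤ 2 * δ}
        {v | infDist (meshPoint δ v) (R.arc 2) ≤ 2 * δ} →
      Quad.rectQuad ((Homeomorph.mulLeft₀ Complex.I Complex.I_ne_zero).trans Φ) (1 - s) (1 + s)
        (by linarith) (by linarith) (fun _ => mem_univ _) ∈ z2QuadConfig univ δ ω := by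
  set H : ℂ ≃ₜ ℂ := (Homeomorph.mulLeft₀ Complex.I Complex.I_ne_zero).trans Φ with hH
  -- the straightening tolerance `η` and the uniform-continuity radius `θ`
  set η : ℝ := s / 8 with hη
  have hηpos : 0 < η := by positivity
  have hηs : 4 * η < s := by rw [hη]; linarith
  have hCc : IsCompact (closure R.carrier) := R.isBounded.isCompact_closure
  obtain ⟨θ, hθ, hθ1, hUC⟩ := exists_forall_dist_symm_lt H hCc hηpos
  -- opposite arcs are at positive distance
  obtain ⟨ε, hε, hεd⟩ := R.exists_pos_forall_lt_dist_arc
  refine ⟨min (θ / 3) (ε / 5), lt_min (by positivity) (by positivity), ?_⟩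
  intro δ hδ hδlt ω hω hcr
  have hδθ : 3 * δ < θ := by
    have := hδlt.trans_le (min_le_left _ _); linarith
  have hδε : 5 * δ < ε := by
    have := hδlt.trans_le (min_le_right _ _); linarith
  obtain ⟨u, hu, v, hv, huS, hvS, hreach⟩ := hcr
  simp only [mem_setOf_eq] at hu hv
  -- nearest points on the arcs
  obtain ⟨p₀, hp₀, hp₀d⟩ := (R.isCompact_arc 0).exists_infDist_eq_dist
    ⟨R.pt 0, R.pt_mem_arc_self 0⟩ (meshPoint δ u)
  obtain ⟨p₂, hp₂, hp₂d⟩ := (R.isCompact_arc 2).exists_infDist_eq_dist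
    ⟨R.pt 2, R.pt_mem_arc_self 2⟩ (meshPoint δ v)
  have hdu : dist (meshPoint δ u) p₀ ≤ 2 * δ := hp₀d ▸ hu
  have hdv : dist (meshPoint δ v) p₂ ≤ 2 * δ := hp₂d ▸ hv
  -- the drawn polyline of the open path
  obtain ⟨W⟩ := hreach
  obtain ⟨L, hLc, hLconn, huL, hvL, hnear, hLO⟩ := exists_polyline_of_walk hδ hω W
  -- it is not trivial: `u ≠ v` since the arcs `0`, `2` are `ε > 5δ` apart
  have hLO' : L ⊆ openEdgeUnion δ ω := by
    rcases hLO with hLO | hLO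
    · exfalso
      have hvu : meshPoint δ v = meshPoint δ u := by
        have := hvL; rw [hLO] at this; exact mem_singleton_iff.1 this
      have h1 := hεd p₀ hp₀ p₂ hp₂
      have h2 : dist p₀ p₂ ≤ dist p₀ (meshPoint δ u) + dist (meshPoint δ u) p₂ :=
        dist_triangle _ _ _
      have h3 : dist (meshPoint δ u) p₂ ≤ 2 * δ := by rw [← hvu]; exact hdv
      have h4 : dist p₀ (meshPoint δ u) ≤ 2 * δ := by rw [dist_comm]; exact hdu
      linarith
    · exact hLO
  -- read through `H⁻¹`
  set K : Set ℂ := H.symm '' L with hK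
  have hKc : IsCompact K := hLc.image H.symm.continuous
  have hKconn : IsConnected K := hLconn.image _ H.symm.continuous.continuousOn
  have hclosure : R.carrier ⊆ closure R.carrier := subset_closure
  have hKim : ∀ w ∈ K, |w.im| ≤ 1 + η := by
    rintro _ ⟨z, hz, rfl⟩
    obtain ⟨x, hxS, hxd⟩ := hnear z hz
    have hq : meshPoint δ x ∈ closure R.carrier := hclosure hxS
    have hlt : dist (H.symm z) (H.symm (meshPoint δ x)) < η :=
      hUC _ hq z (hxd.trans_lt (by linarith))
    have hsq := symm_image_closure h _ hq
    rw [mem_reProdIm, mem_Icc, mem_Icc] at hsq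
    have him := (abs_im_le_norm (H.symm z - H.symm (meshPoint δ x))).trans_lt
      (by rwa [← dist_eq_norm])
    rw [sub_im] at him
    exact abs_le.2 ⟨by linarith [(abs_lt.1 him).1, hsq.2.1], by linarith [(abs_lt.1 him).2, hsq.2.2]⟩
  have hK₀ : ∃ w ∈ K, w.re ≤ -1 + η := by
    refine ⟨H.symm (meshPoint δ u), mem_image_of_mem _ huL, ?_⟩
    have hq : p₀ ∈ closure R.carrier := R.arc_subset_frontier 0 |>.trans frontier_subset_closure <| hp₀
    have hlt : dist (H.symm (meshPoint δ u)) (H.symm p₀) < η :=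
      hUC _ hq _ (hdu.trans_lt (by linarith))
    have hre := (abs_re_le_norm (H.symm (meshPoint δ u) - H.symm p₀)).trans_lt
      (by rwa [← dist_eq_norm])
    rw [sub_re, symm_image_arc_zero h p₀ hp₀] at hre
    linarith [(abs_lt.1 hre).2]
  have hK₂ : ∃ w ∈ K, 1 - η ≤ w.re := by
    refine ⟨H.symm (meshPoint δ v), mem_image_of_mem _ hvL, ?_⟩
    have hq : p₂ ∈ closure R.carrier := R.arc_subset_frontier 2 |>.trans frontier_subset_closure <| hp₂
    have hlt : dist (H.symm (meshPoint δ v)) (H.symm p₂) < η :=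
      hUC _ hq _ (hdv.trans_lt (by linarith))
    have hre := (abs_re_le_norm (H.symm (meshPoint δ v) - H.symm p₂)).trans_lt
      (by rwa [← dist_eq_norm])
    rw [sub_re, symm_image_arc_two h p₂ hp₂] at hre
    linarith [(abs_lt.1 hre).1]
  -- the band lemma, with the identity as chart
  obtain ⟨K', hK'K, hK'c, hK'conn, hK'sub, hK'0, hK'2⟩ :=
    exists_subcontinuum_crossing (g := id) hs' hηpos hηs continuousOn_id (injOn_id _)
      (fun z _ => by simp [hηpos.le]) hKc hKconn hKim hK₀ hK₂
  rw [image_id] at hK'sub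
  simp only [image_id] at hK'0 hK'2
  -- push forward by `H`: a crossing of `Q_{1-s,1+s}` inside the open edges
  refine mem_z2QuadConfig_of_isCrossing (K := H '' K') ⟨hK'c.image H.continuous,
    hK'conn.image _ H.continuous.continuousOn, ?_, ?_, ?_⟩ ?_
  · rw [carrier_rq]
    exact image_mono hK'sub
  · obtain ⟨w, hwK', hw⟩ := hK'0
    refine ⟨H w, mem_image_of_mem _ hwK', ?_⟩
    rw [side_zero_rq]
    refine mem_image_of_mem _ ⟨hw.2, ?_⟩
    have := hw.1
    rw [mem_reProdIm] at this
    exact this.2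
  · obtain ⟨w, hwK', hw⟩ := hK'2
    refine ⟨H w, mem_image_of_mem _ hwK', ?_⟩
    rw [side_two_rq]
    refine mem_image_of_mem _ ⟨hw.2, ?_⟩
    have := hw.1
    rw [mem_reProdIm] at this
    exact this.2
  · rintro _ ⟨w, hw, rfl⟩
    obtain ⟨z, hz, hzw⟩ := hK'K hw
    rw [← hzw, Homeomorph.apply_symm_apply]
    exact hLO' hz

/-- **Upper per-mesh inequality.**  For `s ∈ (0, 1/2]` and `0 < δ < δ₀(R, s)`, the
`P_{1/2}`-probability of the crude event is at most `μ_δ(⊞_{Q_{1-s,1+s}})`, the law of `S_ω`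
evaluated on the (closed) crossing event of the easier quad (almost every configuration opens
only lattice edges, `setBernoulli_ae_subset`). -/
theorem prob_crude_le_z2QuadLaw {s : ℝ} (hs : 0 < s) (hs' : s ≤ 1 / 2) :
    ∃ δ₀ : ℝ, 0 < δ₀ ∧ ∀ δ : ℝ, 0 < δ → δ < δ₀ →
      bondPercolation (zdGraph 2) half
        (openCrossing {x : Site 2 | meshPoint δ x ∈ R.carrier}
          {u | infDist (meshPoint δ u) (R.arc 0) ≤ 2 * δ}
          {v | infDist (meshPoint δ v) (R.arc 2) ≤ 2 * δ}) ≤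
      (z2QuadLaw (univ : Set ℂ) δ : Measure (QuadConfig (univ : Set ℂ)))
        (QuadConfig.crossedEvent (Quad.rectQuad
          ((Homeomorph.mulLeft₀ Complex.I Complex.I_ne_zero).trans Φ) (1 - s) (1 + s)
          (by linarith) (by linarith) (fun _ => mem_univ _))) := by
  obtain ⟨δ₀, hδ₀, hincl⟩ := crude_subset_crossed h hs hs'
  refine ⟨δ₀, hδ₀, fun δ hδ hδlt => ?_⟩
  rw [z2QuadLaw_apply isOpen_univ hδ (QuadConfig.measurableSet_crossedEvent _)]
  have hae : ∀ᵐ ω ∂bondPercolation (zdGraph 2) half, ω ⊆ (zdGraph 2).edgeSet :=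
    ProbabilityTheory.setBernoulli_ae_subset
  refine measure_mono_ae (hae.mono fun ω hω hcr => ?_)
  exact hincl δ hδ hδlt ω hω hcr

end SquareModel

end Summit.CriticalPhenomena.CardyFormulaZ2.Theorems.MeckeFlipBridge

end
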